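import Summits.ABC.ABC.Theses.RibetTakahashiSplit

/-!
# The known range of the milestone `SubexpABCManyPrimes`: `ε > 1/3` (Stewart–Yu)

Companion of `RibetTakahashiSplitSubexpABCManyPrimes.lean` (item stmt-ABC-1568 of route
`RibetTakahashiSplit`, `log c ≤ κ_ε rad(abc)^ε` for abc triples with `ω(abc) ≥ 5`). This file
records, in Lean, where the unconditional frontier of that milestone lies: for every `ε > 1/3`
the bound holds for ALL abc triples, conditionally only on the named fact
`Literature.NumberTheory.DiophantineGeometry.stewart_yu` (Stewart–Yu, Duke Math. J. 108 (2001),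
Thm 1: `log c ≤ C · R^{1/3} (log R)^3`; undischarged in the tree — lower bounds for linear forms
in logarithms are not in Mathlib). Hence the item is open exactly for `0 < ε ≤ 1/3`, where the
route's crux r2 (`ManyPrimeValuationProduct`) is the intended source
(`subexpABCManyPrimes_of_manyPrimeValuationProduct`).

Not here: anything about `ε ≤ 1/3`.
-/

-- `Summit.<Summit>.<Problem>` is the mandated summit-side namespace (CONVENTIONS §2); for the
-- single-conjunct summit `ABC` the two coincide, so the duplicate `ABC.ABC` is deliberate.
set_option linter.dupNamespace false

namespace Summit.ABC.ABC.Theorems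

open Literature.NumberTheory.DiophantineGeometry UniqueFactorizationMonoid

/-! ### The unconditional frontier: the slice `ε > 1/3` (Stewart–Yu) -/

/-- **What is known towards the milestone.** For `ε > 1/3` the bound `log c ≤ κ_ε · rad(abc)^ε`
holds for ALL abc triples, conditionally only on the named fact
`Literature.NumberTheory.DiophantineGeometry.stewart_yu` (Stewart–Yu 2001, Thm 1:
`log c ≤ C R^{1/3} (log R)^3`, undischarged in the tree — linear forms in logarithms): with
`η = (ε − 1/3)/3`, `log R ≤ R^η/η` gives `(log R)^3 ≤ η^{-3} R^{ε − 1/3}`. So item stmt-ABC-1568 is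
open exactly in the range `0 < ε ≤ 1/3`. [cite: StewartYu2001, Theorem 1] -/
theorem SubexpABCManyPrimes.of_stewart_yu_of_third_lt (hSY : stewart_yu) {ε : ℝ}
    (hε : 1 / 3 < ε) :
    ∃ κ : ℝ, ∀ a b c : ℕ, IsABCTriple a b c → Real.log c ≤ κ * (rad a b c : ℝ) ^ ε := by
  obtain ⟨C, hC⟩ := hSY
  obtain ⟨η, hηε, hη⟩ : ∃ η : ℝ, 1 / 3 + η * 3 = ε ∧ 0 < η :=
    ⟨(ε - 1 / 3) / 3, by ring, by linarith⟩
  refine ⟨max C 0 * (1 / η) ^ 3, fun a b c habc => ?_⟩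
  have h1 := hC a b c habc
  have hrad0 : rad a b c ≠ 0 := by rw [rad_def]; exact radical_ne_zero
  have hR1 : (1 : ℝ) ≤ (rad a b c : ℝ) := by exact_mod_cast Nat.one_le_iff_ne_zero.mpr hrad0
  have hR0 : (0 : ℝ) < (rad a b c : ℝ) := one_pos.trans_le hR1
  have hlog0 : 0 ≤ Real.log (rad a b c : ℝ) := Real.log_nonneg hR1
  have hlog3 : Real.log (rad a b c : ℝ) ^ 3 ≤ ((rad a b c : ℝ) ^ η / η) ^ 3 :=
    pow_le_pow_left₀ hlog0 (Real.log_le_rpow_div hR0.le hη) 3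
  have hpow : (rad a b c : ℝ) ^ (1 / 3 : ℝ) * ((rad a b c : ℝ) ^ η) ^ 3 = (rad a b c : ℝ) ^ ε := by
    rw [← Real.rpow_natCast ((rad a b c : ℝ) ^ η) 3, ← Real.rpow_mul hR0.le, ← Real.rpow_add hR0,
      ← hηε]
    push_cast
    ring_nf
  calc Real.log c ≤ C * (rad a b c : ℝ) ^ (1 / 3 : ℝ) * Real.log (rad a b c : ℕ) ^ 3 := h1
    _ ≤ max C 0 * (rad a b c : ℝ) ^ (1 / 3 : ℝ) * Real.log (rad a b c : ℕ) ^ 3 :=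
        mul_le_mul_of_nonneg_right
          (mul_le_mul_of_nonneg_right (le_max_left _ _) (Real.rpow_nonneg hR0.le _))
          (pow_nonneg hlog0 3)
    _ ≤ max C 0 * (rad a b c : ℝ) ^ (1 / 3 : ℝ) * ((rad a b c : ℝ) ^ η / η) ^ 3 :=
        mul_le_mul_of_nonneg_left hlog3 (by positivity)
    _ = max C 0 * (1 / η) ^ 3 * ((rad a b c : ℝ) ^ (1 / 3 : ℝ) * ((rad a b c : ℝ) ^ η) ^ 3) := by
        rw [div_pow]
        field_simp
    _ = max C 0 * (1 / η) ^ 3 * (rad a b c : ℝ) ^ ε := by rw [hpow]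

end Summit.ABC.ABC.Theorems
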